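import Mathlib
import Summits.ResolutionOfSingularities.ResolutionOfSingularities.Theses.WeightedInvariant

/-!
# Sketch — first lemmas of the crux idea cards for `DescentPerfectToAll` (stmt-0549)

Elaboration check only (no proofs). Namespace as required by the crux protocol.
-/

namespace Summit.ResolutionOfSingularities.ResolutionOfSingularities.Cruxes.DescentPerfectToAll.Sketch

open AlgebraicGeometry CategoryTheory CategoryTheory.Limits
open Literature.AlgebraicGeometry.Resolution

/-- Card `lambda-tower-one-step` — FIRST LEMMA (one-step detection of `k`-regularity, `p`-degree-1
form). Let `k` have characteristic `p` and `p`-basis `{t}` (every `x ∈ k` is uniquely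
`∑_{j<p} c_j^p t^j`). Let `E ≤ E₁` be subfields of `k` with `t ∈ E` and `E₁ ⊇ λ_t(E)` (all the
`p`-components `c_j` of elements of `E` lie in `E₁`). Then for every `E`-scheme `X` locally of finite
type, `X ×_E E₁` is regular iff `X ×_E k` is regular. (Relative form of EGA IV₂ 6.7.7; the case
`k = E^{perf}`, empty `p`-basis, `E₁ = E^{1/p}` is the classical one.) -/
def OneStepDetection (p : ℕ) : Prop :=
  ∀ (k : Type) [Field k] [CharP k p] (t : k),
    (∀ x : k, ∃! c : Fin p → k, x = ∑ j : Fin p, (c j) ^ p * t ^ (j : ℕ)) →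
    ∀ (E E₁ : Subfield k) (hle : E ≤ E₁), t ∈ E →
    (∀ x : k, x ∈ E → ∀ c : Fin p → k, x = ∑ j : Fin p, (c j) ^ p * t ^ (j : ℕ) → ∀ j, c j ∈ E₁) →
    ∀ (X : Scheme.{0}) (f : X ⟶ Spec (.of E)), LocallyOfFiniteType f → QuasiCompact f →
      (Scheme.IsRegular (pullback f (Spec.map (CommRingCat.ofHom (Subfield.inclusion hle)))) ↔
        Scheme.IsRegular (pullback f (Spec.map (CommRingCat.ofHom E.subtype))))

/-- Card `lambda-tower-one-step` — support: separable (= formally smooth) extension of the ground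
field preserves resolutions (EGA IV₂ 6.7.4.1 + proper/birational base change). -/
def SeparableAscent : Prop :=
  ∀ (E k : Type) [Field E] [Field k] [Algebra E k] [Algebra.FormallySmooth E k]
    (X : Scheme.{0}) (f : X ⟶ Spec (.of E)),
    IsSeparated f → LocallyOfFiniteType f → QuasiCompact f → IsReduced X →
    Scheme.HasResolution X →
    Scheme.HasResolution (pullback f (Spec.map (CommRingCat.ofHom (algebraMap E k))))

/-- Card `lambda-tower-one-step` — TRANSFER target `C⁺` (robust resolution one λ-step up, `p`-degree
1): with `k, t, E, E₁` as in `OneStepDetection` and `E` finitely generated over `𝔽_p`, every reduced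
separated finite-type `E`-scheme `X` whose base change to `k` is reduced admits, for some `n`, after
replacing `E ≤ E₁` by the `n`-th and `(n+1)`-st λ-hulls, a proper birational `Y → X_{E_n}` with
`Y ×_{E_n} E_{n+1}` regular.  Informal here (the λ-hull tower is data); the typed kernel is
`OneStepDetection` + `SeparableAscent`, which give `C⁺ → DescentPerfectToAll` restricted to `k` of
`p`-degree 1. -/
def RobustResolutionInformal : Prop := True

/-- Card `frobenius-sandwich-foliation` — FIRST LEMMA (perfect-closure descent): resolution over
perfect fields of characteristic `p` gives, for every reduced separated finite-type `X` over ANY field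
`k` of characteristic `p`, a finite purely inseparable `k₁/k`, the reduced structure `Z` of `X ×_k k₁`
(a surjective closed immersion), and a resolution `Y → Z` with `Y` SMOOTH over `k₁` — i.e. a regular,
`k₁`-smooth purely inseparable alteration `Y → X` of degree dividing `[k₁ : k]`. -/
def PerfectClosureDescent (p : ℕ) : Prop :=
  (∀ (k : Type) [Field k] [CharP k p] [PerfectField k] (X : Scheme.{0}) (f : X ⟶ Spec (.of k)),
      IsSeparated f → LocallyOfFiniteType f → QuasiCompact f → IsReduced X → Scheme.HasResolution X) →
  ∀ (k : Type) [Field k] [CharP k p] (X : Scheme.{0}) (f : X ⟶ Spec (.of k)),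
    IsSeparated f → LocallyOfFiniteType f → QuasiCompact f → IsReduced X →
    ∃ (k₁ : Type) (_ : Field k₁) (_ : Algebra k k₁) (_ : IsPurelyInseparable k k₁) (_ : Module.Finite k k₁)
      (Z Y : Scheme.{0}) (i : Z ⟶ pullback f (Spec.map (CommRingCat.ofHom (algebraMap k k₁))))
      (π : Y ⟶ Z),
      IsClosedImmersion i ∧ Surjective i ∧ IsReduced Z ∧ IsResolution π ∧
      Smooth (π ≫ i ≫ pullback.snd f (Spec.map (CommRingCat.ofHom (algebraMap k k₁))))

/-- Sanity: the crux decl this folder ideates on (type-checks that the route decl is in scope). -/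
example : Prop := Summit.ResolutionOfSingularities.ResolutionOfSingularities.Theses.WeightedInvariant.DescentPerfectToAll

end Summit.ResolutionOfSingularities.ResolutionOfSingularities.Cruxes.DescentPerfectToAll.Sketch
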